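import Summits.CriticalPhenomena.PercolationContinuityZ3.Theorems.SahiMasterFamilyAllOrders
import Summits.CriticalPhenomena.PercolationContinuityZ3.Theorems.SahiMasterFamilyPrivateGluing
import Summits.CriticalPhenomena.PercolationContinuityZ3.Theorems.SahiMasterFamilyMinors
import Literature.Probability.Percolation.TwoClusterConditionalSahi
import Literature.Combinatorics.Sahi2008.PushForward

/-!
# Theorem R at every order: the identically-zero master conjecture reduces to TERMINAL families

Unit `prim-master-conj` (crux anchor stmt-CriticalPhenomena-4575), gen 7.  Order 3 is the tree's `sahiE3Nonvanishing_of_terminal`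
(`SahiMasterFamilyMinors`); here every order `k = n + 3`.  A family `U` of `k` increasing events determined by `S` is TERMINAL if
(i) no `(k−1)`-sub-family is a zero flag, (ii) NO coordinate is pivotal for all `k` members, (iii) NO coordinate is PRIVATE (pivotal for one
member, acting on no other), and (iv) every minor (both `e`-sections, `e ∈ S`) is a zero flag of order `k`.
**Theorem R** (`nonvanishing_of_terminal_all`): if terminal families are non-vanishing (some interior `p` with `E_k(μ_p) ≠ 0`) and families
with a common pivotal coordinate are non-vanishing ((T-a), `SahiMasterFamilyCoordPoly.sahiENonvanishing_of_common_pivotal_all`), then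
(T_k) holds: EVERY family with no zero-flag sub-family is non-vanishing — hence `MasterFamilyIdentEqIff k` (`masterFamilyIdentEqIff_of_terminal_all`,
via `masterFamilyIdentEqIff_iff_nonvanishing`).  Induction on `|S|`: a non-terminal family has a common pivotal coordinate ((T-a)), or a
private coordinate — then not both minors are zero flags, by PRIVATE GLUING (`suppZeroFlag_of_minors_of_private`) and (i) — or some minor
outside `Z_k`; such a minor is non-vanishing by the induction hypothesis or, if it has a zero-flag sub-family, by the all-order step
(`masterFamily_step_all`) at the centre; and non-vanishing of a minor lifts (`exists_sahiE_ne_zero_of_sec`, all orders: `E_k` at the boundary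
parameter `p_e = b` is `E_k` of the `b`-sections — the functional only sees moments, `BHK2006.sahiE_eq_of_ex_eq` — sections ignore `p_e`
(push-forward along `forceAt e false`, `sahiE_pushWeight`), and an `E_k` vanishing on the open cube vanishes on the closed cube by continuity).
No conjecture asserted; axioms standard. [this work]
-/

noncomputable section

open scoped Classical Topology

namespace Summit.CriticalPhenomena.PercolationContinuityZ3.Theorems

open Finset Function Filter
open Literature.Combinatorics.Sahi2008
open Literature.Probability.LatticeModels.Kahn2022 (Affects)
open Literature.Probability.Percolation (DeterminedBy)
open Literature.Probability.Percolation.DecisionTree (ind ind_of_mem ind_of_not_mem)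

variable {ι : Type} [Fintype ι]

/-! ### Transfer between a family and its minors, every order -/

/-- An `E_k` vanishing on the open cube vanishes on the closed cube (continuity in `p`). [this work] -/
theorem sahiE_eq_zero_of_forall_interior {k : ℕ} (F : Fin k → Set ι → ℝ)
    (h : ∀ q : ι → unitInterval, (∀ e, (q e : ℝ) ∈ Set.Ioo (0 : ℝ) 1) → sahiE (bernoulliWeight q) k F = 0)
    (p : ι → unitInterval) : sahiE (bernoulliWeight p) k F = 0 := by
  have h1 : Tendsto (fun m : ℕ => sahiE (bernoulliWeight (shrink p m)) k F) atTop (𝓝 (sahiE (bernoulliWeight p) k F)) :=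
    ((continuous_sahiE_bernoulliWeight k F).tendsto p).comp (tendsto_shrink p)
  have h2 : (fun m : ℕ => sahiE (bernoulliWeight (shrink p m)) k F) = fun _ => 0 :=
    funext fun m => h _ (shrink_mem_Ioo p m)
  rw [h2] at h1
  exact tendsto_nhds_unique h1 tendsto_const_nhds

omit [Fintype ι] in
/-- Indicators of sections are pulled-back indicators. [folklore] -/
theorem ind_secAt_eq_comp (e : ι) (b : Bool) (A : Set (Set ι)) : ind (secAt e b A) = ind A ∘ forceAt e b := by
  funext ω
  by_cases h : ω ∈ secAt e b A
  · rw [ind_of_mem h, Function.comp_apply, ind_of_mem (mem_secAt.1 h)]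
  · rw [ind_of_not_mem h, Function.comp_apply, ind_of_not_mem fun h' => h (mem_secAt.2 h')]

/-- At the boundary parameter `p_e = b` the product measure only sees `h ∘ forceAt e b`. [this work] -/
theorem ex_update_boolParam_comp_forceAt (p : ι → unitInterval) (e : ι) (b : Bool) (h : Set ι → ℝ) :
    ex (bernoulliWeight (update p e (boolParam b))) h = ex (bernoulliWeight (update p e (boolParam b))) (h ∘ forceAt e b) := by
  rw [ex_update_eq, ex_update_eq]
  cases b
  · have h0 : secEx p e (h ∘ forceAt e false) false = secEx p e h false := by
      simp only [secEx, Bool.false_eq_true, if_false]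
      refine sum_congr rfl fun ω hω => ?_
      simp only [mem_filter, mem_univ, true_and] at hω
      simp only [Function.comp_apply, forceAt, cond_false, Set.sdiff_singleton_eq_self hω]
    simp [boolParam, h0]
  · have h1 : secEx p e (h ∘ forceAt e true) true = secEx p e h true := by
      simp only [secEx, if_true, Function.comp_apply, forceAt, cond_true, Set.insert_idem]
    simp [boolParam, h1]

/-- **`E_k` at the boundary parameter `p_e = b` is `E_k` of the `b`-sections**, every order. [this work] -/
theorem sahiE_update_boolParam_eq_secAt (p : ι → unitInterval) (e : ι) (b : Bool) {k : ℕ} (U : Fin k → Set (Set ι)) :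
    sahiE (bernoulliWeight (update p e (boolParam b))) k (fun j => ind (U j)) =
      sahiE (bernoulliWeight (update p e (boolParam b))) k (fun j => ind (secAt e b (U j))) := by
  rw [Literature.Probability.Percolation.BHK2006.sahiE_eq_of_ex_eq _ _ (forceAt e b)
    (ex_update_boolParam_comp_forceAt p e b) k]
  simp only [ind_secAt_eq_comp]

/-- **`E_k` of a family of sections does not depend on `p_e`**, every order (push-forward along `forceAt e false`). [this work] -/
theorem sahiE_secAt_update_eq (p : ι → unitInterval) (e : ι) (b : Bool) (s s' : unitInterval) {k : ℕ} (U : Fin k → Set (Set ι)) :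
    sahiE (bernoulliWeight (update p e s)) k (fun j => ind (secAt e b (U j))) =
      sahiE (bernoulliWeight (update p e s')) k (fun j => ind (secAt e b (U j))) := by
  have hcomp : (fun j => ind (secAt e b (U j))) = fun j => ind (secAt e b (U j)) ∘ forceAt e false := by
    funext j ω
    simp only [Function.comp_apply, forceAt, cond_false]
    by_cases he : e ∈ ω
    · conv_lhs => rw [← Set.insert_eq_of_mem he, ← Set.insert_sdiff_singleton, ind_secAt_insert]
    · rw [Set.sdiff_singleton_eq_self he]
  have hpush : pushWeight (bernoulliWeight (update p e s)) (forceAt e false) =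
      pushWeight (bernoulliWeight (update p e s')) (forceAt e false) := by
    funext c
    rw [pushWeight_eq_ex, pushWeight_eq_ex]
    exact ex_update_eq_of_ignores p e s s' fun ω => by simp only [forceAt_insert]
  rw [hcomp, ← sahiE_pushWeight, ← sahiE_pushWeight, hpush]

/-- **Transfer**: if `E_k(μ_q; 1_U) = 0` for every interior `q`, then every minor has `E_k = 0` at every `p`. [this work] -/
theorem sahiE_sec_eq_zero_of_forall {k : ℕ} (U : Fin k → Set (Set ι))
    (h : ∀ q : ι → unitInterval, (∀ i, (q i : ℝ) ∈ Set.Ioo (0 : ℝ) 1) → sahiE (bernoulliWeight q) k (fun j => ind (U j)) = 0)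
    (e : ι) (b : Bool) (p : ι → unitInterval) : sahiE (bernoulliWeight p) k (fun j => ind (secAt e b (U j))) = 0 := by
  have hbd := sahiE_eq_zero_of_forall_interior (fun j => ind (U j)) h (update p e (boolParam b))
  rw [sahiE_update_boolParam_eq_secAt] at hbd
  have hp : p = update p e (p e) := by rw [update_eq_self]
  rw [hp, sahiE_secAt_update_eq p e b (p e) (boolParam b)]
  exact hbd

/-- **Transfer, contrapositive**: non-vanishing of a minor somewhere in the open cube lifts to the family, every order. [this work] -/
theorem exists_sahiE_ne_zero_of_sec {k : ℕ} (U : Fin k → Set (Set ι)) (e : ι) (b : Bool)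
    (h : ∃ p : ι → unitInterval, (∀ i, (p i : ℝ) ∈ Set.Ioo (0 : ℝ) 1) ∧
      sahiE (bernoulliWeight p) k (fun j => ind (secAt e b (U j))) ≠ 0) :
    ∃ p : ι → unitInterval, (∀ i, (p i : ℝ) ∈ Set.Ioo (0 : ℝ) 1) ∧ sahiE (bernoulliWeight p) k (fun j => ind (U j)) ≠ 0 := by
  by_contra hall
  push Not at hall
  obtain ⟨p, _, hne⟩ := h
  exact hne (sahiE_sec_eq_zero_of_forall U hall e b p)

/-- A minor outside the zero-flag class is non-vanishing, by the induction hypothesis (no zero-flag sub-family) or by the all-order step at the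
centre of the cube (some zero-flag sub-family). [this work] -/
theorem exists_ne_zero_of_not_suppZeroFlag {n : ℕ} (V : Fin (n + 3) → Set (Set ι)) (hV : ∀ j, IsUpperSet (V j))
    (hZ : ¬ SuppZeroFlag (n + 3) V)
    (ih : (∀ m : Fin (n + 3), ¬ SuppZeroFlag (n + 2) (fun j => V (m.succAbove j))) →
      ∃ p : ι → unitInterval, (∀ i, (p i : ℝ) ∈ Set.Ioo (0 : ℝ) 1) ∧ sahiE (bernoulliWeight p) (n + 3) (fun j => ind (V j)) ≠ 0) :
    ∃ p : ι → unitInterval, (∀ i, (p i : ℝ) ∈ Set.Ioo (0 : ℝ) 1) ∧ sahiE (bernoulliWeight p) (n + 3) (fun j => ind (V j)) ≠ 0 := by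
  by_cases hsub : ∃ m : Fin (n + 3), SuppZeroFlag (n + 2) (fun j => V (m.succAbove j))
  · obtain ⟨m, hm⟩ := hsub
    refine ⟨halfParams ι, halfParams_mem_Ioo ι, fun h0 => hZ ?_⟩
    exact (((masterFamily_step_all (halfParams ι) V hV m hm).2 (halfParams_mem_Ioo ι)).1 h0)
  · push Not at hsub
    exact ih hsub

/-! ### Theorem R, every order -/

/-- **Theorem R at every order.**  Let `k = n + 3`.  Suppose (T-a): families of `k` increasing events with a common pivotal coordinate are
non-vanishing; and suppose every TERMINAL family — no zero-flag `(k−1)`-sub-family, no common pivotal coordinate, no private coordinate, all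
minors in `Z_k` — is non-vanishing.  Then (T_k): every family of `k` increasing events with no zero-flag sub-family has `E_k(μ_p) ≠ 0` for some
interior `p`. [this work] -/
theorem nonvanishing_of_terminal_all (n : ℕ)
    (hTa : ∀ (ι : Type) [Fintype ι] (U : Fin (n + 3) → Set (Set ι)), (∀ j, IsUpperSet (U j)) → ∀ e : ι,
      (∀ j, ∃ ω, e ∉ ω ∧ ω ∉ U j ∧ insert e ω ∈ U j) →
        ∃ p : ι → unitInterval, (∀ i, (p i : ℝ) ∈ Set.Ioo (0 : ℝ) 1) ∧ sahiE (bernoulliWeight p) (n + 3) (fun j => ind (U j)) ≠ 0)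
    (hterm : ∀ (ι : Type) [Fintype ι] (U : Fin (n + 3) → Set (Set ι)) (S : Finset ι), (∀ j, IsUpperSet (U j)) →
      (∀ j, DeterminedBy (U j) (↑S : Set ι)) →
      (∀ m : Fin (n + 3), ¬ SuppZeroFlag (n + 2) (fun j => U (m.succAbove j))) →
      (¬ ∃ e : ι, ∀ j, ∃ ω, e ∉ ω ∧ ω ∉ U j ∧ insert e ω ∈ U j) →
      (¬ ∃ e : ι, ∃ c : Fin (n + 3), (∃ ω, e ∉ ω ∧ ω ∉ U c ∧ insert e ω ∈ U c) ∧ ∀ j, j ≠ c → ¬ Affects (U j) e) →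
      (∀ e ∈ S, ∀ b : Bool, SuppZeroFlag (n + 3) (fun j => secAt e b (U j))) →
        ∃ p : ι → unitInterval, (∀ i, (p i : ℝ) ∈ Set.Ioo (0 : ℝ) 1) ∧ sahiE (bernoulliWeight p) (n + 3) (fun j => ind (U j)) ≠ 0) :
    ∀ (ι : Type) [Fintype ι] (U : Fin (n + 3) → Set (Set ι)), (∀ j, IsUpperSet (U j)) →
      (∀ m : Fin (n + 3), ¬ SuppZeroFlag (n + 2) (fun j => U (m.succAbove j))) →
        ∃ p : ι → unitInterval, (∀ i, (p i : ℝ) ∈ Set.Ioo (0 : ℝ) 1) ∧ sahiE (bernoulliWeight p) (n + 3) (fun j => ind (U j)) ≠ 0 := by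
  -- induction on the size of a determining set
  have main : ∀ (N : ℕ) (ι : Type) [Fintype ι] (U : Fin (n + 3) → Set (Set ι)) (S : Finset ι), S.card = N →
      (∀ j, IsUpperSet (U j)) → (∀ j, DeterminedBy (U j) (↑S : Set ι)) →
      (∀ m : Fin (n + 3), ¬ SuppZeroFlag (n + 2) (fun j => U (m.succAbove j))) →
        ∃ p : ι → unitInterval, (∀ i, (p i : ℝ) ∈ Set.Ioo (0 : ℝ) 1) ∧
          sahiE (bernoulliWeight p) (n + 3) (fun j => ind (U j)) ≠ 0 := by
    intro N
    induction N with
    | zero =>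
      intro ι _ U S hS hU hUS hno
      by_cases hc : ∃ e : ι, ∀ j, ∃ ω, e ∉ ω ∧ ω ∉ U j ∧ insert e ω ∈ U j
      · obtain ⟨e, he⟩ := hc
        exact hTa ι U hU e he
      · have hS0 : S = ∅ := Finset.card_eq_zero.1 hS
        refine hterm ι U S hU hUS hno hc ?_ fun e he => ?_
        · rintro ⟨e, c, ⟨ω, heω, hω, hin⟩, -⟩
          -- `e` acts on `U c`, which is determined by `S = ∅`
          have := ((Literature.Probability.Percolation.determinedBy_iff _ _).1 (hUS c)) ω (insert e ω) (by rw [hS0]; simp)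
          exact hω (this.2 hin)
        · rw [hS0] at he; exact absurd he (Finset.notMem_empty e)
    | succ N ih =>
      intro ι _ U S hS hU hUS hno
      by_cases hc : ∃ e : ι, ∀ j, ∃ ω, e ∉ ω ∧ ω ∉ U j ∧ insert e ω ∈ U j
      · obtain ⟨e, he⟩ := hc
        exact hTa ι U hU e he
      -- a minor outside `Z_k` settles the family
      have minor : ∀ e ∈ S, ∀ b : Bool, ¬ SuppZeroFlag (n + 3) (fun j => secAt e b (U j)) →
          ∃ p : ι → unitInterval, (∀ i, (p i : ℝ) ∈ Set.Ioo (0 : ℝ) 1) ∧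
            sahiE (bernoulliWeight p) (n + 3) (fun j => ind (U j)) ≠ 0 := by
        intro e heS b hZ
        set V : Fin (n + 3) → Set (Set ι) := fun j => secAt e b (U j) with hV
        have hVup : ∀ j, IsUpperSet (V j) := fun j => isUpperSet_secAt e b (hU j)
        have hVdet : ∀ j, DeterminedBy (V j) (↑(S.erase e) : Set ι) := fun j => determinedBy_secAt e b (hUS j)
        have hcard : (S.erase e).card = N := by rw [Finset.card_erase_of_mem heS, hS]; rfl
        exact exists_sahiE_ne_zero_of_sec U e b
          (exists_ne_zero_of_not_suppZeroFlag V hVup hZ fun hVno => ih ι V (S.erase e) hcard hVup hVdet hVno)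
      by_cases hpriv : ∃ e : ι, ∃ c : Fin (n + 3), (∃ ω, e ∉ ω ∧ ω ∉ U c ∧ insert e ω ∈ U c) ∧ ∀ j, j ≠ c → ¬ Affects (U j) e
      · -- a private coordinate: not both minors are zero flags (private gluing + no zero-flag sub-family)
        obtain ⟨e, c, ⟨ω, heω, hω, hin⟩, hfree⟩ := hpriv
        have heS : e ∈ S := by
          by_contra heS
          have := ((Literature.Probability.Percolation.determinedBy_iff _ _).1 (hUS c)) ω (insert e ω) (by
            ext i
            simp only [Set.mem_inter_iff, Set.mem_insert_iff, Finset.mem_coe]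
            constructor
            · rintro ⟨hi, hiS⟩; exact ⟨Or.inr hi, hiS⟩
            · rintro ⟨rfl | hi, hiS⟩
              · exact absurd hiS heS
              · exact ⟨hi, hiS⟩)
          exact hω (this.2 hin)
        by_cases h0 : SuppZeroFlag (n + 3) (fun j => secAt e false (U j))
        · by_cases h1 : SuppZeroFlag (n + 3) (fun j => secAt e true (U j))
          · have hZU : SuppZeroFlag (n + 3) U := suppZeroFlag_of_minors_of_private U hU c e hfree h0 h1
            obtain ⟨m, hm, -⟩ := hZU
            exact absurd hm (hno m)
          · exact minor e heS true h1
        · exact minor e heS false h0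
      by_cases hall : ∀ e ∈ S, ∀ b : Bool, SuppZeroFlag (n + 3) (fun j => secAt e b (U j))
      · exact hterm ι U S hU hUS hno hc hpriv hall
      · push Not at hall
        obtain ⟨e, heS, b, hZ⟩ := hall
        exact minor e heS b hZ
  intro ι _ U hU hno
  have hdet : ∀ j, DeterminedBy (U j) (↑(Finset.univ : Finset ι) : Set ι) := by
    intro j
    rw [Literature.Probability.Percolation.determinedBy_iff]
    intro ω ω' h
    simp only [Finset.coe_univ, Set.inter_univ] at h
    rw [h]
  exact main _ ι U Finset.univ rfl hU hdet hno

/-- **The identically-zero master conjecture at order `k = n+3` follows from (T-a) and non-vanishing of terminal families.** [this work] -/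
theorem masterFamilyIdentEqIff_of_terminal_all (n : ℕ)
    (hTa : ∀ (ι : Type) [Fintype ι] (U : Fin (n + 3) → Set (Set ι)), (∀ j, IsUpperSet (U j)) → ∀ e : ι,
      (∀ j, ∃ ω, e ∉ ω ∧ ω ∉ U j ∧ insert e ω ∈ U j) →
        ∃ p : ι → unitInterval, (∀ i, (p i : ℝ) ∈ Set.Ioo (0 : ℝ) 1) ∧ sahiE (bernoulliWeight p) (n + 3) (fun j => ind (U j)) ≠ 0)
    (hterm : ∀ (ι : Type) [Fintype ι] (U : Fin (n + 3) → Set (Set ι)) (S : Finset ι), (∀ j, IsUpperSet (U j)) →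
      (∀ j, DeterminedBy (U j) (↑S : Set ι)) →
      (∀ m : Fin (n + 3), ¬ SuppZeroFlag (n + 2) (fun j => U (m.succAbove j))) →
      (¬ ∃ e : ι, ∀ j, ∃ ω, e ∉ ω ∧ ω ∉ U j ∧ insert e ω ∈ U j) →
      (¬ ∃ e : ι, ∃ c : Fin (n + 3), (∃ ω, e ∉ ω ∧ ω ∉ U c ∧ insert e ω ∈ U c) ∧ ∀ j, j ≠ c → ¬ Affects (U j) e) →
      (∀ e ∈ S, ∀ b : Bool, SuppZeroFlag (n + 3) (fun j => secAt e b (U j))) →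
        ∃ p : ι → unitInterval, (∀ i, (p i : ℝ) ∈ Set.Ioo (0 : ℝ) 1) ∧ sahiE (bernoulliWeight p) (n + 3) (fun j => ind (U j)) ≠ 0) :
    MasterFamilyIdentEqIff (n + 3) :=
  (masterFamilyIdentEqIff_iff_nonvanishing n).2 (nonvanishing_of_terminal_all n hTa hterm)

end Summit.CriticalPhenomena.PercolationContinuityZ3.Theorems
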